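import Mathlib
import HarnessLib
import Summits.BirchSwinnertonDyer.BirchSwinnertonDyer.Theses.PrintX6
import Literature.NumberTheory.EllipticCurves.HeegnerPoints

/-!
# Line `all-inert` for crux `PrintX6.EisensteinHalfFiveLeRest` (stmt-BirchSwinnertonDyer-21116)

bsd-idea-8 g0 · lens **nearmiss** · D-0152 / W-71 bind (crux-level only; BSD is NOT proved by any of this).

**Near-miss argument.** Bertolini–Longo–Venerucci, *The anticyclotomic main conjectures for elliptic
curves*, Math. Ann. (2026), doi:10.1007/s00208-026-03381-0 (arXiv:2306.17784) — Theorems B/C (the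
`ε`-BSD formulae over the finite anticyclotomic layers, here only the bottom layer `n = 0`) at a GOOD
SUPERSINGULAR prime `p ≥ 5` SPLIT in `K` (their non-exceptional case, both signs): for `K` imaginary
quadratic with EVERY prime of the (squarefree) conductor `N` INERT in `K` (their Hyp. 1.1 forces
`N⁺ = 1` for a semistable curve: `H⁰(I_q, E[p]) = 0` fails at every multiplicative `q`), `p ∤ N h_K`,
`(d_K, Np) = 1`, `ρ̄_{E,p}` irreducible (automatic: good supersingular, `p ≥ 5`) and (CR⁺) «`q ‖ N`,
`q ≡ ±1 (mod p)` ⇒ `E[p]` ramified at `q`» (= `p ∤ ord_q Δ_min`, Tate), one gets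
`length Sel_{p^∞}(E/K) = ord_p (L(E/K,1)/C)` when `ν(N)` is odd (definite, sign `+1`, Thm B) and
`length Ш(E/K)[p^∞] = ord_p (L'(E/K,1)/(C·Reg))` when `ν(N)` is even (indefinite, sign `−1`, Thm C).
With `L(E/K,s) = L(E,s)·L(E^{d_K},s)`, `Ш(E/K)[p^∞] ≅ Ш(E/ℚ)[p^∞] ⊕ Ш(E^{d_K}/ℚ)[p^∞]` (`p` odd) and
the Gross / Gross–Zagier period bookkeeping (Cai–Shu–Tian 2014) this is the `p`-part of BSD for
`E/K`, i.e. a LOWER bound for `ord_p #Ш(E/ℚ) + ord_p #Ш(E^{d_K}/ℚ)`; the published UPPER bound for the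
twist (Kato 2004 + Kobayashi 2003 / Wuthrich 2014 Prop. 21 in rank 0; Kobayashi 2013 in rank 1) then
isolates the lower bound for `E` — the conclusion of `EisensteinHalfFiveLeRest` — on every `Rest`
curve satisfying (CR⁺), with NO condition on the number or splitting type of the `E[p]`-ramified
multiplicative primes (the cell's roads (E) = erratum prime, (I) = inert PAIR + unit rider both need
them; the refined residual `RestThin` = `¬HasErratumPrime ∧ ¬HasInertPairPrimeToUnits` is exactly
where they run out).

**Measured deficit (the single input to improve).** The EQUALITY halves of BLV Thms B/C at a
supersingular `p` rest, at exactly one step (MS p. 31: «Results of Skinner–Urban–Wan ([S-U] and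
Theorem B of [Sk] in the ordinary case, [Wan1] and [Wan2] in the supersingular case) prove the
inequality `ord_𝔓 L(ξ/K,1)_alg ≤ length Sel_{𝔓^∞}(J_ξ/K) + Σ_{q ∣ NL} t_ξ(q)`» for the level-raised
newforms `ξ`), on [Wan1] = X. Wan, *Iwasawa main conjecture for supersingular elliptic curves*,
preprint 2015 = arXiv:1411.6352, WITHDRAWN (Burungale–Skinner–Tian–Wan arXiv:2409.01350v2 Rem. 1.4 (i);
tree: `X6RankOneOneSided.lean` docstring), and [Wan2] (preprint 2016; published descendant
Castella–Liu–Wan, Forum Math. Sigma 10 (2022) e110, whose divisibility holds only in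
`Λ^ur ⊗ Frac(Λ^{cyc,ur})` — BSTW MS p. 74 — so the trivial-character specialisation is not immediate).
The inequality direction that IS unconditional in BLV (`length ≤ ord`, bipartite Euler system:
Bertolini–Darmon 2005, Darmon–Iovita 2008, Burungale–Büyükboduk–Lei, Adv. Math. 439 (2024) 109465)
is the UPPER bound — the wrong half for this crux. So the line's hardest stub is that ONE rank-`0`
anticyclotomic lower bound at supersingular `p` (stub `stub_allInertProductLowerBound`), and its
cheapest falsifier is a literature check, not a computation: does CLW22 Thm 1.2 + BSTW-free control
deliver BLV's p. 31 inequality for weight-2 newforms of squarefree level `N·L` (all of `N·L` inert in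
`K`, `p` split, `a_p(ξ) ≡ 0`)? If yes the road is refereed (PUB) modulo formalisation; if no it is
PUB* exactly like the census flag `JSW-ss`.

**Stubs** (all fact-free, because the crux is fact-free as typed; each docstring names the printed
source a by-name discharge would transcribe):
* `stub_allInertTwistSupply` (L) — an all-inert `K` with `p` split, `p ∤ h_K`, and a globally minimal
  model of `E^{d_K}` of analytic rank `≤ 1` (Friedberg–Hoffstein 1995 Thm B with INERT local conditions
  × Wiles 2015 / Beckwith 2017 indivisibility of `h_K` with local conditions — the JOINT prescription is
  not in print: why it might fail);
* `stub_allInertProductLowerBound` (XL, HARDEST, the near-miss input) — the `p`-part of BSD for `E/K`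
  as a lower bound in PRODUCT currency (`ord_p Ш_an(E) + ord_p Ш_an(E^{d_K}) ≤ ord_p #Ш(E) + ord_p #Ш(E^{d_K})`)
  under BLV Hyp. 1.1 + (CR⁺);
* `stub_twistUpperBound` (M–L, in print) — `MissingUpperBoundAt` for the minimal model of `E^{d_K}` in
  analytic rank `≤ 1` at the good supersingular `p ∤ d_K` (rank 0: Kato 2004 Thm 17.4 + Kobayashi 2003
  Thm 1.3, or Wuthrich 2014 Prop. 21 `sha_dvd_analyticSha` with `ClassX6.surj` carried through `χ_{d_K}`;
  rank 1: Kobayashi 2013 Thm 1.3 / Sprung 2024 Cor. 1.3 (ii) — for a NON-semistable twist, to be checked);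
* `stub_crPlusResidue` (RESIDUAL, declared, no lever named) — the `Rest` body on the curves violating
  (CR⁺): some `ℓ ∣ N` with `ℓ ≡ ±1 (mod p)` and `p ∣ ord_ℓ Δ_min` (`E[p]` unramified at `ℓ`). Candidates:
  Kim 2022 Kurihara-number criterion per curve (as the cell closed the two `RestThin` cells
  `246697a1@5`, `321518d1@5`), or Ribet level-lowering to remove `ℓ` before running BLV.
The composition `EisensteinHalfFiveLeRest_of : PrintX6.EisensteinHalfFiveLeRest` invokes the four stubs BY
NAME: `by_cases` on (CR⁺) + cast injectivity `ℚ → ℂ` + linear arithmetic on the two valuation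
inequalities; it concludes the crux BY NAME (sorries only inside the stubs).
-/

set_option autoImplicit false

open WeierstrassCurve NumberField Literature.NumberTheory.EllipticCurves
  Literature.NumberTheory.EllipticCurves.Rank1Residual
  Summit.BirchSwinnertonDyer.Rank1Residual.Supersingular

namespace Summit.BirchSwinnertonDyer.BirchSwinnertonDyer.Cruxes.EisensteinHalfFiveLeRest.AllInert

/-- **stub (L) — all-inert twist supply.** For `E` in X6 at `p ≥ 5` with `L(E,1) ≠ 0` there is an
imaginary quadratic `K` with every prime of the conductor INERT (one prime above, unramified), `p`
SPLIT, `p ∤ h_K`, together with a globally minimal model `W'` of the quadratic twist `E^{d_K}` of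
analytic rank `≤ 1` (its parity is then forced: `w(E^{d_K}) = w(E/K) = (−1)^{1+ν(N)}`).
In print separately: Friedberg–Hoffstein 1995 Thm B (non-vanishing / simple zero of quadratic twists
with finitely many prescribed local components; the tree transcribes only the Heegner-split case,
`friedbergHoffstein_exists_heegnerField_split_twist_ne_zero`), Wiles 2015 / Beckwith 2017
(infinitely many `K` with `p ∤ h_K` and prescribed behaviour at finitely many primes).
Why it might fail: the JOINT prescription (twist `L`-value condition ∧ `p ∤ h_K` ∧ all-inert) is not
in print. -/
theorem stub_allInertTwistSupply :
    ∀ (W : WeierstrassCurve ℚ) [W.IsElliptic] [W.IsGloballyMinimal] (p : ℕ) [Fact p.Prime],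
      5 ≤ p → ClassX6 W p → W.analyticRank = 0 →
      ∃ (K : Type) (_ : Field K) (_ : NumberField K),
        IsImaginaryQuadratic K ∧
        (∀ ℓ : ℕ, ℓ.Prime → ℓ ∣ W.conductorNorm ℤ →
          ((Ideal.span {(ℓ : ℤ)}).primesOver (𝓞 K)).ncard = 1 ∧ ¬ (ℓ : ℤ) ∣ NumberField.discr K) ∧
        SatisfiesHeegnerHypothesis p K ∧ ¬ p ∣ NumberField.classNumber K ∧
        ∃ (W' : WeierstrassCurve ℚ) (_ : W'.IsElliptic) (_ : W'.IsGloballyMinimal) (u : VariableChange ℚ),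
          u • W.quadraticTwist (NumberField.discr K : ℚ) = W' ∧ W'.analyticRank ≤ 1 := by
  sorry

/-- **stub (XL, HARDEST) — the all-inert product lower bound (the near-miss input).** For `E` in X6
at `p ≥ 5`, non-CM, `L(E,1) ≠ 0`, satisfying (CR⁺) «`ℓ ∣ N`, `ℓ ≡ ±1 (mod p)` ⇒ `p ∤ ord_ℓ Δ_min`», and
`K`, `W'` as supplied above: `Ш_an(E)` and `Ш_an(E^{d_K})` are rational and
`ord_p Ш_an(E) + ord_p Ш_an(E^{d_K}) ≤ ord_p #Ш(E/ℚ) + ord_p #Ш(E^{d_K}/ℚ)` — the `p`-part of BSD for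
`E/K` read as a lower bound, via `L(E/K,s) = L(E,s)L(E^{d_K},s)`, `Ш(E/K)[p^∞] ≅ Ш(E)[p^∞] ⊕ Ш(E^{d_K})[p^∞]`
(`p` odd) and the Gross / Gross–Zagier period and Tamagawa bookkeeping (Cai–Shu–Tian 2014).
Source: Bertolini–Longo–Venerucci, Math. Ann. 2026 (arXiv:2306.17784) Thm B (`ν(N)` odd, definite,
`r_an(E^{d_K}) = 0`) / Thm C (`ν(N)` even, indefinite, `r_an(E^{d_K}) = 1`), `n = 0`, `p` split
(non-exceptional).
Why it might fail: the equality half of Thms B/C at supersingular `p` cites [Wan1] (arXiv:1411.6352,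
withdrawn) / [Wan2] (preprint; CLW22's published divisibility is only in `Λ^ur ⊗ Frac(Λ^{cyc,ur})`) for
the inequality `ord_𝔓 L(ξ/K,1)_alg ≤ length Sel + Σ t_ξ(q)` (MS p. 31) — PUB* until that step is sourced. -/
theorem stub_allInertProductLowerBound :
    ∀ (W : WeierstrassCurve ℚ) [W.IsElliptic] [W.IsGloballyMinimal] (p : ℕ) [Fact p.Prime],
      ¬ W.HasCM → 5 ≤ p → ClassX6 W p → W.analyticRank = 0 →
      (∀ ℓ : ℕ, ℓ.Prime → ℓ ∣ W.conductorNorm ℤ → (p ∣ ℓ + 1 ∨ p ∣ ℓ - 1) →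
        ¬ p ∣ padicValInt ℓ W.minimalDiscriminantInt) →
      ∀ (K : Type) [Field K] [NumberField K], IsImaginaryQuadratic K →
        (∀ ℓ : ℕ, ℓ.Prime → ℓ ∣ W.conductorNorm ℤ →
          ((Ideal.span {(ℓ : ℤ)}).primesOver (𝓞 K)).ncard = 1 ∧ ¬ (ℓ : ℤ) ∣ NumberField.discr K) →
        SatisfiesHeegnerHypothesis p K → ¬ p ∣ NumberField.classNumber K →
        ∀ (W' : WeierstrassCurve ℚ) [W'.IsElliptic] [W'.IsGloballyMinimal] (u : VariableChange ℚ),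
          u • W.quadraticTwist (NumberField.discr K : ℚ) = W' → W'.analyticRank ≤ 1 →
          ∃ q q' : ℚ, shaAn W = (q : ℂ) ∧ shaAn W' = (q' : ℂ) ∧
            padicValRat p q + padicValRat p q' ≤
              (padicValNat p W.shaOrder : ℤ) + (padicValNat p W'.shaOrder : ℤ) := by
  sorry

/-- **stub (M–L, in print) — upper bound for the twist.** For `E` in X6 at `p ≥ 5`, non-CM, and `K`,
`W'` as above (`p` split in `K`, so `p ∤ d_K` and `W'` has good supersingular reduction at `p` with
`a_p(W') = ±a_p(E) = 0`; `ρ̄_{W',p} = ρ̄_{E,p} ⊗ χ_{d_K}` is onto `GL₂(𝔽_p)` because `ρ̄_{E,p}` is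
(`ClassX6.surj`)): `Ш_an(W')` is rational and `ord_p #Ш(W'/ℚ) ≤ ord_p Ш_an(W')` (`MissingUpperBoundAt W' p`).
Sources: rank 0 — Kato 2004 Thm 17.4 + Kobayashi 2003 Thm 1.3 (`a_p = 0`), or Wuthrich 2014 Prop. 21
(`Wuthrich2014.sha_dvd_analyticSha`: exceptions only at `2`, additive primes and non-surjective
irreducible images — none is `p`); rank 1 — Kobayashi 2013 Thm 1.3 / Sprung 2024 Cor. 1.3 (ii).
Why it might fail: the rank-1 sources are stated for curves with good reduction at `p` but their
auxiliary hypotheses on a NON-semistable twist must be checked; inside this fact-free crux the stub is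
a formalisation target unless the route's published-inputs pack (children5 v2) is granted by name. -/
theorem stub_twistUpperBound :
    ∀ (W : WeierstrassCurve ℚ) [W.IsElliptic] [W.IsGloballyMinimal] (p : ℕ) [Fact p.Prime],
      ¬ W.HasCM → 5 ≤ p → ClassX6 W p →
      ∀ (K : Type) [Field K] [NumberField K], IsImaginaryQuadratic K →
        (∀ ℓ : ℕ, ℓ.Prime → ℓ ∣ W.conductorNorm ℤ →
          ((Ideal.span {(ℓ : ℤ)}).primesOver (𝓞 K)).ncard = 1 ∧ ¬ (ℓ : ℤ) ∣ NumberField.discr K) →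
        SatisfiesHeegnerHypothesis p K →
        ∀ (W' : WeierstrassCurve ℚ) [W'.IsElliptic] [W'.IsGloballyMinimal] (u : VariableChange ℚ),
          u • W.quadraticTwist (NumberField.discr K : ℚ) = W' → W'.analyticRank ≤ 1 →
          ∃ q' : ℚ, shaAn W' = (q' : ℂ) ∧ (padicValNat p W'.shaOrder : ℤ) ≤ padicValRat p q' := by
  sorry

/-- **stub (RESIDUAL, declared — no lever named)** — the `Rest` body on the curves violating (CR⁺):
some `ℓ ∣ N` with `ℓ ≡ ±1 (mod p)` and `p ∣ ord_ℓ Δ_min` (`E[p]` unramified at `ℓ`; BLV Hyp. 1.1 last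
bullet fails for every all-inert `K`). Candidates, not claims: Ribet 1990 level-lowering removes such
`ℓ` from the level of `ρ̄` (the (CR⁺) clause guards the freeness / Ihara step of the bipartite Euler
system, so a by-name repair is not automatic); Kim 2022 Kurihara numbers per curve; BSTW Thm 1.3 (PRE).
Why it might fail: it is the crux restricted to a congruence-defined sub-class, as open as the crux there. -/
theorem stub_crPlusResidue :
    ∀ (W : WeierstrassCurve ℚ) [W.IsElliptic] [W.IsGloballyMinimal] (p : ℕ) [Fact p.Prime],
      ¬ W.HasCM → 5 ≤ p → ClassX6 W p → W.analyticRank = 0 → ¬ HasErratumPrime W p →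
      ¬ (∀ ℓ : ℕ, ℓ.Prime → ℓ ∣ W.conductorNorm ℤ → (p ∣ ℓ + 1 ∨ p ∣ ℓ - 1) →
        ¬ p ∣ padicValInt ℓ W.minimalDiscriminantInt) →
      ∀ q : ℚ, shaAn W = (q : ℂ) → padicValRat p q ≠ 0 →
        padicValRat p q ≤ (padicValNat p W.shaOrder : ℤ) := by
  sorry

/-- **Composition (sorry-free): the four stubs prove the crux `PrintX6.EisensteinHalfFiveLeRest` BY
NAME.** Case (CR⁺): supply `K, W'`; the product lower bound and the twist upper bound squeeze out
`ord_p Ш_an(E) ≤ ord_p #Ш(E/ℚ)` (cast injectivity `ℚ → ℂ` identifies the rational values of `Ш_an`);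
case ¬(CR⁺): the residual stub. -/
theorem EisensteinHalfFiveLeRest_of :
    Summit.BirchSwinnertonDyer.BirchSwinnertonDyer.Theses.PrintX6.EisensteinHalfFiveLeRest := by
  intro W hE hGM p hp hCM h5 hX6 hr0 hRest q hq hvq
  by_cases hCR : ∀ ℓ : ℕ, ℓ.Prime → ℓ ∣ W.conductorNorm ℤ → (p ∣ ℓ + 1 ∨ p ∣ ℓ - 1) →
      ¬ p ∣ padicValInt ℓ W.minimalDiscriminantInt
  · obtain ⟨K, iF, iN, hIQ, hInert, hpK, hhK, W', iE', iM', u, hu, hr1⟩ :=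
      stub_allInertTwistSupply W p h5 hX6 hr0
    letI : Field K := iF
    letI : NumberField K := iN
    letI : W'.IsElliptic := iE'
    letI : W'.IsGloballyMinimal := iM'
    obtain ⟨q₀, q', hq₀, hq', hle⟩ :=
      stub_allInertProductLowerBound W p hCM h5 hX6 hr0 hCR K hIQ hInert hpK hhK W' u hu hr1
    obtain ⟨q'', hq'', hup⟩ := stub_twistUpperBound W p hCM h5 hX6 K hIQ hInert hpK W' u hu hr1
    have e₁ : q₀ = q := by exact_mod_cast hq₀.symm.trans hq
    have e₂ : q'' = q' := by exact_mod_cast hq''.symm.trans hq'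
    subst e₁ e₂
    linarith
  · exact stub_crPlusResidue W p hCM h5 hX6 hr0 hRest hCR q hq hvq

end Summit.BirchSwinnertonDyer.BirchSwinnertonDyer.Cruxes.EisensteinHalfFiveLeRest.AllInert
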